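import Summits.Ventures.CertifiedArithmetic.Expansions.CompressCarryBound
import Mathlib.Algebra.Field.GeomSum
import Mathlib.Tactic.FieldSimp

/-!
# Tools for the power-of-two sharpening of the COMPRESS top error (new work)

New work of the certified-arithmetic venture (ENGINES group: shared numerical engines serving
client cells; rigour lives in the verifiers; every published number belongs to a client cell's
ledger, not to the engines group), continuing the tree's analysis of Shewchuk's COMPRESS
(`Literature/ComputerArithmetic/Shewchuk1997/Compress.lean`: `compress`, `compressUp`, `UpInv`;
`Expansions/CompressTopError.lean`: `compress_top_error`, the top component `L` of
`compress fl e` satisfies `|Σe − L| ≤ ulp(L)/2 · (1 + ε + ⋯ + ε^(k−1))`, `ε = 2^-p`).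

This file supplies the two step lemmas of the SHARPENING AT POWERS OF TWO proved in
`Expansions/CompressTopErrorPow2.lean`: when `|L| = 2^a` and the lower components point from `L`
towards zero, the bound halves — `|Σe − L| ≤ ulp(L)/4 · (1 + ε + ⋯)` — i.e. the error is governed
by the ulp of the EXACT sum, which drops by a factor two just inside a power of two.

* `carry_lt_half_ulp_of_pow2` — THE EMITTING STEP ONTO A POWER OF TWO FROM INSIDE: in the second
  traversal, if `Qn = fl(g + Q) ≠ g + Q`, `|Qn| = 2^a`, `|g + Q| < 2^a`, `|Q| ≤ ulp g` and the
  carry bound `|Q| < ulp Qn` (`compressUp_carry_lt_ulp`) holds, then even `|Q| < ulp(Qn)/2`.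
  (If `|Q| ≥ 2^(a−p)`: with `g`, `Q` aligned, `|g| < 2^a` forces `ulp g ≤ 2^(a−p)`, so
  `|Q| = 2^(a−p)` and `g + Q` lies on the grid `2^(a−p)ℤ` below `2^a`, hence is a float —
  but the step was inexact; with `Q` against `g`, `|g| ≥ 2^a`, and either `|g| = 2^a` (then the
  roundoff `≤ ulp(Qn)/4` gives `|Q| ≤ 2^(a−p)/2`) or `|g| ≥ 2^a + 2^(a−p+1)` (then
  `|Q| > ulp Qn`).)
* `sum_le_quarter_ulp_after_absorb` — THE EXACT STEP: if `g + Q` is a float with `|g + Q| = 2^a`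
  then `ulp Q ≤ ulp(g + Q)/2`, because `|Q| < |g + Q|`; the single configuration with
  `|g + Q| = |Q|` (`p = 2`, `|g| = 2^(u+1) = 2·ulp g`, `|Q| = 2^u`) is excluded by the sharp
  stair under the power of two `g` (`compressDown_sharp_stair`), exactly as in the carry bound.
* small tools: the geometric factor (`geomFactor_succ/nonneg/lt`, restated here because the
  copies in `CompressTopError.lean` are private), the quarter-ulp roundoff at a power of two
  approached from inside (`abs_sub_fl_le_quarter_ulp_of_pow2`), sign bookkeeping, and
  `ulp Q > 2^emin` / `ulp Q ≤ 2^(E−p)` for a state `UpInv p emin 1 (r :: tl) Q` with `|Q| < 2^E`.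

All statements are over the tree's definitions (`IsFloat`, `IsRoundNearest` = ANY
round-to-nearest, `ulp` with gradual underflow, `UpInv`); `p ≥ 2` where rounding matters.

HONEST FRAMING: elementary floating-point lemmas of this programme, checked in Lean; not a
published result and no open problem.  Shewchuk's paper [Shewchuk1997, §2.7 Thm 23 p. 331–333]
and the survey [BoldoEtAl2023, §2] supply only the objects (COMPRESS, ulp, round-to-nearest).

References: [Shewchuk1997] J. R. Shewchuk, Adaptive precision floating-point arithmetic and fast
robust geometric predicates, DCG 18 (1997), §2.7; [BoldoEtAl2023] Boldo, Jeannerod, Melquiond,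
Muller, Floating-point arithmetic, Acta Numerica 32 (2023), §2.
-/

namespace Summit.Ventures.CertifiedArithmetic.Expansions

open Literature.ComputerArithmetic.JeannerodRump2018
open Literature.ComputerArithmetic.BoldoJeannerodMelquiondMuller2023 hiding twoSum twoSum_fst
open Literature.ComputerArithmetic.JoldesMullerPopescu2017 (ulp_le_of_abs_lt_two_zpow)
open Literature.ComputerArithmetic.GraillatMuller2025 (ulp_two_zpow)
open Literature.ComputerArithmetic.Shewchuk1997

variable {p : ℕ} {emin : ℤ} {fl : ℚ → ℚ}

/-! ### Small tools -/

/-- `1 + ε + ⋯ + ε^k = 1 + ε·(1 + ⋯ + ε^(k−1))`, `ε = 2^-p`. -/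
theorem geomFactor_succ (k : ℕ) :
    (Finset.range (k + 1)).sum (fun i => ((2 : ℚ) ^ p)⁻¹ ^ i) =
      1 + ((2 : ℚ) ^ p)⁻¹ * (Finset.range k).sum (fun i => ((2 : ℚ) ^ p)⁻¹ ^ i) := by
  rw [Finset.sum_range_succ', pow_zero, Finset.mul_sum, add_comm]
  congr 1
  refine Finset.sum_congr rfl (fun i _ => ?_)
  rw [pow_succ, mul_comm]

/-- The geometric factor is nonnegative. -/
theorem geomFactor_nonneg (k : ℕ) :
    0 ≤ (Finset.range k).sum (fun i => ((2 : ℚ) ^ p)⁻¹ ^ i) :=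
  Finset.sum_nonneg (fun i _ => pow_nonneg (inv_nonneg.mpr (by positivity)) i)

/-- The geometric factor is below its limit `2^p/(2^p − 1)`. -/
theorem geomFactor_lt (hp : 1 ≤ p) (k : ℕ) :
    (Finset.range k).sum (fun i => ((2 : ℚ) ^ p)⁻¹ ^ i) < 2 ^ p / (2 ^ p - 1) := by
  have hT : (1 : ℚ) < 2 ^ p := one_lt_pow₀ (by norm_num) (by omega)
  have hT1 : (0 : ℚ) < 2 ^ p - 1 := by linarith
  induction k with
  | zero => rw [Finset.sum_range_zero]; exact div_pos (by positivity) hT1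
  | succ k ih =>
    rw [geomFactor_succ]
    have hstep : ((2 : ℚ) ^ p)⁻¹ * (Finset.range k).sum (fun i => ((2 : ℚ) ^ p)⁻¹ ^ i) <
        ((2 : ℚ) ^ p)⁻¹ * (2 ^ p / (2 ^ p - 1)) :=
      mul_lt_mul_of_pos_left ih (inv_pos.mpr (by positivity))
    have hid : 1 + ((2 : ℚ) ^ p)⁻¹ * (2 ^ p / (2 ^ p - 1)) = 2 ^ p / (2 ^ p - 1) := by
      field_simp; ring
    linarith

/-- A round-to-nearest error is at most `ulp(fl t)/4` when `|fl t| = 2^j` (`j ≥ emin + p`) is a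
power of two approached from inside (`|t| < |fl t|`). (Cf. [BoldoEtAl2023, §2.1]: the
roundoff is at most half an ulp of the EXACT value `t`, and `ulp t = ulp(fl t)/2` here.) -/
theorem abs_sub_fl_le_quarter_ulp_of_pow2 (hp : 1 ≤ p) (hfl : IsRoundNearest p emin fl) (t : ℚ)
    {j : ℤ} (hj : emin + p ≤ j) (hpow : |fl t| = 2 ^ j) (hlt : |t| < |fl t|) :
    |t - fl t| ≤ ulp p emin (fl t) / 4 := by
  have hE : emin ≤ j - p + 1 := by omega
  have hut : ulp p emin t ≤ (2 : ℚ) ^ (j - p) :=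
    ulp_le_of_abs_lt_two_zpow (by rw [← hpow]; exact hlt) (by omega)
  have huf : ulp p emin (fl t) = 2 * (2 : ℚ) ^ (j - p) := by
    rw [← ulp_abs, hpow, ulp_two_zpow hE, show j - p + 1 = (j - p) + 1 by ring,
      zpow_add_one₀ (by norm_num : (2 : ℚ) ≠ 0), mul_comm]
  have := abs_sub_fl_le_half_ulp hp hfl t
  rw [huf]; linarith

/-- If `|s| < |q|` and `(q + s)·X < 0` then `q·X < 0`: the dominant summand decides the sign. -/
theorem mul_neg_of_abs_lt_of_add_mul_neg {q s X : ℚ} (h : |s| < |q|) (hneg : (q + s) * X < 0) :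
    q * X < 0 := by
  rcases mul_neg_iff.mp hneg with ⟨h1, h2⟩ | ⟨h1, h2⟩
  · have hq : 0 < q := by
      by_contra hq; rw [not_lt] at hq
      rw [abs_of_nonpos hq] at h
      linarith [le_abs_self s]
    exact mul_neg_of_pos_of_neg hq h2
  · have hq : q < 0 := by
      by_contra hq; rw [not_lt] at hq
      rw [abs_of_nonneg hq] at h
      linarith [neg_abs_le s]
    exact mul_neg_of_neg_of_pos hq h2

/-- `|a + b| = |a| − |b|` when `b` points against `a` and is not larger. -/
theorem abs_add_eq_sub_abs_of_mul_neg {a b : ℚ} (h : b * a < 0) (hle : |b| ≤ |a|) :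
    |a + b| = |a| - |b| := by
  rcases mul_neg_iff.mp h with ⟨hb, ha⟩ | ⟨hb, ha⟩
  · rw [abs_of_neg ha, abs_of_pos hb] at *
    rw [abs_of_nonpos (by linarith)]; ring
  · rw [abs_of_pos ha, abs_of_neg hb] at *
    rw [abs_of_nonneg (by linarith)]; ring

/-- In a list of nonzero floats each 1-below the previous ones, a NONEMPTY list does not sum to
zero, so its sum is at least `2^emin` in magnitude; if moreover the sum is below `ulp Q`, then
`ulp Q > 2^emin`. -/
theorem two_zpow_emin_lt_ulp_of_upInv_cons {r Q : ℚ} {tl : List ℚ}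
    (inv : UpInv p emin 1 (r :: tl) Q) : (2 : ℚ) ^ emin < ulp p emin Q := by
  have htail : |tl.sum| < |r| := abs_sum_tail_lt_head inv.floats inv.pw inv.ne
  have hne : (r :: tl).sum ≠ 0 := by
    rw [List.sum_cons]; intro h
    have : |r| = |tl.sum| := by rw [show r = -tl.sum by linarith, abs_neg]
    linarith
  have hgrid : OnGrid emin (r :: tl).sum :=
    OnGrid.listSum (fun x hx => OnGrid.of_isFloat (inv.floats x hx))
  exact (hgrid.two_zpow_le_abs hne).trans_lt inv.sum_lt

/-- … hence `|Q| < 2^E` with `E ≤ emin + p - 1` is impossible for such a state, and in general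
`ulp Q ≤ 2^(E - p)` follows from `|Q| < 2^E`. -/
theorem ulp_le_two_zpow_of_upInv_cons {r Q : ℚ} {tl : List ℚ} {E : ℤ}
    (inv : UpInv p emin 1 (r :: tl) Q) (hQ : |Q| < (2 : ℚ) ^ E) :
    emin ≤ E - p ∧ ulp p emin Q ≤ (2 : ℚ) ^ (E - p) := by
  have hlt := two_zpow_emin_lt_ulp_of_upInv_cons inv
  have hE : emin ≤ E - p := by
    by_contra h; rw [not_le] at h
    have hQsmall : |Q| < (2 : ℚ) ^ (emin + p - 1) :=
      hQ.trans_le (zpow_le_zpow_right₀ (by norm_num) (by omega))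
    rw [ulp_eq_of_abs_lt hQsmall] at hlt
    exact lt_irrefl _ hlt
  exact ⟨hE, ulp_le_of_abs_lt_two_zpow hQ hE⟩

/-! ### The two extra facts of the sharp invariant -/

/-- EMITTING ONTO A POWER OF TWO FROM INSIDE: if `Qn = fl(g + Q) ≠ g + Q` with `|Qn| = 2^a`,
`|g + Q| < 2^a`, `|Q| ≤ ulp g` and `|Q| < ulp Qn` (the carry bound), then the old carry is even
below HALF the ulp of the new one: `|Q| < 2^(a-p) = ulp(Qn)/2`. -/
theorem carry_lt_half_ulp_of_pow2 (hp : 2 ≤ p) (hfl : IsRoundNearest p emin fl) {g Q : ℚ}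
    {a : ℤ} (hg : IsFloat p emin g) (hQg : |Q| ≤ ulp p emin g) (ha : emin + p ≤ a)
    (hQn : |fl (g + Q)| = 2 ^ a) (hin : |g + Q| < (2 : ℚ) ^ a) (hne : fl (g + Q) ≠ g + Q)
    (hcarry : |Q| < ulp p emin (fl (g + Q))) : |Q| < (2 : ℚ) ^ (a - p) := by
  have hp1 : 1 ≤ p := le_trans (by norm_num) hp
  have h2 : (2 : ℚ) ≠ 0 := by norm_num
  set t := g + Q with ht_def
  have hulpQn : ulp p emin (fl t) = (2 : ℚ) ^ (a - p + 1) := by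
    rw [← ulp_abs, hQn, ulp_two_zpow (by omega)]
  have hq4 : |t - fl t| ≤ ulp p emin (fl t) / 4 :=
    abs_sub_fl_le_quarter_ulp_of_pow2 hp1 hfl t ha hQn (by rw [hQn]; exact hin)
  have e1 : (2 : ℚ) ^ (a - p + 1) = 2 ^ (a - p) * 2 := by
    rw [show a - p + 1 = (a - p) + 1 by ring, zpow_add_one₀ h2]
  have hDpos : (0 : ℚ) < (2 : ℚ) ^ (a - p) := zpow_pos (by norm_num) _
  -- `|t| ≥ 2^a − 2^(a-p)/2`
  have ht_ge : (2 : ℚ) ^ a - 2 ^ (a - p) / 2 ≤ |t| := by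
    have h3 : |fl t| - |t| ≤ |t - fl t| := by
      rw [abs_sub_comm]; exact abs_sub_abs_le_abs_sub _ _
    rw [hulpQn, e1] at hq4; rw [hQn] at h3; linarith
  -- `2^(a-p+1) ≤ 2^a - 2^(a-p)`: the float range leaves room (`p ≥ 2`)
  have hroom : (2 : ℚ) ^ (a - p) * 4 ≤ 2 ^ a := by
    have hP : (4 : ℚ) ≤ (2 : ℚ) ^ (p : ℤ) := by
      rw [zpow_natCast]
      calc (4 : ℚ) = 2 ^ 2 := by norm_num
        _ ≤ 2 ^ p := pow_le_pow_right₀ (by norm_num) hp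
    have hsplit : (2 : ℚ) ^ a = 2 ^ (a - p) * 2 ^ (p : ℤ) := by
      rw [← zpow_add₀ h2]; congr 1; ring
    rw [hsplit]; exact mul_le_mul_of_nonneg_left hP hDpos.le
  rw [hulpQn, e1] at hcarry
  by_contra hQbig
  rw [not_lt] at hQbig
  have hQt : |Q| < |t| := by linarith
  have ht0 : t ≠ 0 := by
    intro h; rw [h, abs_zero] at hQt; linarith [abs_nonneg Q]
  have hQ0 : Q ≠ 0 := by
    intro h; rw [h, abs_zero] at hQbig; linarith
  have hnf : ¬ IsFloat p emin t := fun hf => hne (fl_eq_self hfl hf)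
  -- (A) `g` and `Q` on the same side: `|g| = |t| − |Q| < 2^a`, and `|Q| = ulp g = 2^(a-p)` would
  -- put `t` on the grid of `2^(a-p)` inside the float range
  have caseA : |g| = |t| - |Q| → False := by
    intro hgabs
    have hg_lt : |g| < (2 : ℚ) ^ a := by linarith [abs_nonneg Q]
    have hulpg : ulp p emin g ≤ (2 : ℚ) ^ (a - p) := ulp_le_of_abs_lt_two_zpow hg_lt (by omega)
    have hQeq : |Q| = (2 : ℚ) ^ (a - p) := le_antisymm (hQg.trans hulpg) hQbig
    have hmg : OnGrid (a - p) g := onGrid_of_two_zpow_le_ulp hg (by rw [← hQeq]; exact hQg)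
    have hmQ : OnGrid (a - p) Q := by
      rcases (abs_eq hDpos.le).mp hQeq with h' | h'
      · rw [h']; exact OnGrid.two_zpow le_rfl
      · rw [h']; exact (OnGrid.two_zpow le_rfl).neg
    have hge := two_zpow_le_abs_of_onGrid_of_not_isFloat (p := p) (by omega : emin ≤ a - p)
      (hmg.add hmQ) hnf
    rw [show a - (p : ℤ) + p = a by ring] at hge
    exact absurd hin (not_lt.mpr hge)
  -- (B) `Q` points against `g`: `|g| = |t| + |Q|`; then `|g| ≥ 2^a`, and either `|g| = 2^a`
  -- (so `|Q| ≤ 2^(a-p)/2`) or `|g| ≥ 2^a + 2^(a-p+1)` (so `|Q| > ulp Qn`)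
  have caseB : |g| = |t| + |Q| → False := by
    intro hgabs
    have hg_ge : (2 : ℚ) ^ a ≤ |g| := by
      by_contra hlt; rw [not_le] at hlt
      have hulpg : ulp p emin g ≤ (2 : ℚ) ^ (a - p) := ulp_le_of_abs_lt_two_zpow hlt (by omega)
      linarith [hQg.trans hulpg]
    rcases hg_ge.lt_or_eq with hgt | heq
    · have hfa : IsFloat p emin ((2 : ℚ) ^ a) :=
        ⟨1, a, by rw [abs_one]; exact one_lt_pow₀ (by norm_num) (by omega), by omega, by simp⟩
      have hulpg : (2 : ℚ) ^ (a - p + 1) ≤ ulp p emin g := by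
        have := ulp_mono (p := p) (emin := emin) (show |(2 : ℚ) ^ a| ≤ |g| by
          rw [abs_of_pos (zpow_pos (by norm_num) _)]; exact hg_ge)
        rwa [ulp_two_zpow (by omega : emin ≤ a - p + 1)] at this
      have hgrid : OnGrid (a - p + 1) g := onGrid_of_two_zpow_le_ulp hg hulpg
      have h2a : OnGrid (a - p + 1) ((2 : ℚ) ^ a) := OnGrid.two_zpow (by omega)
      have := h2a.add_two_zpow_le hgrid.abs hgt
      linarith
    · linarith
  -- the sign analysis deciding between (A) and (B)
  rcases lt_or_gt_of_ne ht0 with htn | htp <;> rcases lt_or_gt_of_ne hQ0 with hQn' | hQp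
  · apply caseA
    rw [abs_of_neg htn, abs_of_neg hQn'] at *
    have : g = t - Q := by rw [ht_def]; ring
    rw [this, abs_of_nonpos (by linarith)]; ring
  · apply caseB
    rw [abs_of_neg htn, abs_of_pos hQp] at *
    have : g = t - Q := by rw [ht_def]; ring
    rw [this, abs_of_neg (by linarith)]; ring
  · apply caseB
    rw [abs_of_pos htp, abs_of_neg hQn'] at *
    have : g = t - Q := by rw [ht_def]; ring
    rw [this, abs_of_pos (by linarith)]; ring
  · apply caseA
    rw [abs_of_pos htp, abs_of_pos hQp] at *
    have : g = t - Q := by rw [ht_def]; ring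
    rw [this, abs_of_nonneg (by linarith)]


/-- THE EXACT STEP keeps the sharp invariant.  After an exact `g ⊕ Q = g + Q` with
`|g + Q| = 2^a`, the components emitted so far satisfy `|Σ rs| ≤ ulp(g + Q)/4 · G` given
`|Σ rs| ≤ ulp(Q)/2 · G`: indeed `ulp Q ≤ ulp(g + Q)/2` because `|Q| < |g + Q|` — the only
configuration with `|g + Q| = |Q|` (`p = 2`, `|g| = 2·ulp g`, `Q = ∓ulp g`) is excluded by the
sharp stair under the power of two `g`. -/
theorem sum_le_quarter_ulp_after_absorb (hp : 2 ≤ p) {g Q : ℚ} {rs : List ℚ} {a : ℤ}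
    (inv : UpInv p emin 1 rs Q) (hgbig : (2 : ℚ) ^ (emin + p) ≤ |g|)
    (hQg : |Q| ≤ ulp p emin g) (hQn : |g + Q| = 2 ^ a)
    (hI : |rs.sum| ≤ ulp p emin Q / 2 *
      (Finset.range rs.length).sum (fun i => ((2 : ℚ) ^ p)⁻¹ ^ i))
    (hsharp : (∃ j : ℤ, emin + p ≤ j ∧ |g| = 2 ^ j) → g * (Q + rs.sum) < 0 →
      |Q + rs.sum| < ulp p emin g / 2) :
    |rs.sum| ≤ ulp p emin (g + Q) / 4 *
      (Finset.range rs.length).sum (fun i => ((2 : ℚ) ^ p)⁻¹ ^ i) := by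
  have h2 : (2 : ℚ) ≠ 0 := by norm_num
  cases rs with
  | nil => simp
  | cons r tl =>
    -- `ulp Q = 2^k > 2^emin`, so `Q` is normal: `2^(k+p-1) ≤ |Q|`
    have hlt := two_zpow_emin_lt_ulp_of_upInv_cons inv
    obtain ⟨k, hk, hK⟩ := exists_ulp_eq_two_zpow (p := p) (emin := emin) Q
    have hk1 : emin < k := by
      by_contra h; rw [not_lt] at h
      rw [hK, le_antisymm h hk] at hlt; exact lt_irrefl _ hlt
    have hQnorm : (2 : ℚ) ^ (k + p - 1) ≤ |Q| := two_zpow_le_abs_of_ulp_eq hK hk1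
    -- `ulp g = 2^u`, `2^(u+p-1) ≤ |g|`
    obtain ⟨u, hu, hU⟩ := exists_ulp_eq_two_zpow (p := p) (emin := emin) g
    have hu1 : emin + 1 ≤ u := by
      have h := two_zpow_le_ulp_of_le_abs (p := p) (emin := emin) (emin + p) hgbig
      rw [hU, show emin + (p : ℤ) - p + 1 = emin + 1 by ring] at h
      exact (zpow_le_zpow_iff_right₀ (by norm_num : (1 : ℚ) < 2)).mp h
    have hgnorm : (2 : ℚ) ^ (u + p - 1) ≤ |g| := two_zpow_le_abs_of_ulp_eq hU (by omega)
    have hg0 : g ≠ 0 := by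
      intro h; rw [h, abs_zero] at hgbig
      exact absurd hgbig (not_le.mpr (zpow_pos (by norm_num) _))
    -- the key inequality `|Q| < |g + Q|`
    have hQlt : |Q| < |g + Q| := by
      have e2 : (2 : ℚ) ^ (u + p - 1) = 2 ^ u * 2 ^ (p : ℤ) / 2 := by
        rw [zpow_sub_one₀ h2, zpow_add₀ h2]; ring
      have hP : (4 : ℚ) ≤ (2 : ℚ) ^ (p : ℤ) := by
        rw [zpow_natCast]
        calc (4 : ℚ) = 2 ^ 2 := by norm_num
          _ ≤ 2 ^ p := pow_le_pow_right₀ (by norm_num) hp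
      have hUpos : (0 : ℚ) < 2 ^ u := zpow_pos (by norm_num) _
      have hg2 : 2 * (2 : ℚ) ^ u ≤ |g| := by rw [e2] at hgnorm; nlinarith
      rw [hU] at hQg
      have htri : |g| - |Q| ≤ |g + Q| := by
        have := abs_add_le (g + Q) (-Q)
        rw [abs_neg, add_neg_cancel_right] at this
        linarith
      by_contra hge
      rw [not_lt] at hge
      -- all inequalities are equalities: `|g| = 2^(u+1)`, `|Q| = 2^u = |g + Q|`
      have hgeq : |g| = 2 * 2 ^ u := by linarith
      have hQeq : |Q| = 2 ^ u := by linarith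
      have hgQeq : |g + Q| = 2 ^ u := by linarith
      have hj : emin + (p : ℤ) ≤ u + 1 := by
        have : (2 : ℚ) ^ (emin + p) ≤ 2 ^ (u + 1) := by rw [zpow_add_one₀ h2]; linarith
        exact (zpow_le_zpow_iff_right₀ (by norm_num : (1 : ℚ) < 2)).mp this
      have hgpow : |g| = 2 ^ (u + 1) := by rw [zpow_add_one₀ h2, hgeq]; ring
      -- `Q`, hence `Q + Σ rs`, points against the power of two `g`
      have hgQ_lt : |g + Q| < |g| := by rw [hgQeq, hgeq]; linarith
      have hrs_lt : |(r :: tl).sum| < |Q| := by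
        refine inv.sum_lt.trans_le ?_
        rw [hK]
        exact (zpow_le_zpow_right₀ (by norm_num) (by omega)).trans hQnorm
      have hsgn : g * (Q + (r :: tl).sum) < 0 := by
        rcases lt_or_gt_of_ne hg0 with hgn | hgp
        · have hQp : 0 < Q := by
            by_contra hle; rw [not_lt] at hle
            rw [abs_of_neg hgn, abs_of_nonpos (by linarith : g + Q ≤ 0)] at hgQ_lt
            rw [abs_of_nonpos hle] at hQg; linarith
          have : 0 < Q + (r :: tl).sum := by
            rw [abs_of_pos hQp] at hrs_lt; linarith [neg_abs_le (r :: tl).sum]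
          exact mul_neg_of_neg_of_pos hgn this
        · have hQn' : Q < 0 := by
            by_contra hle; rw [not_lt] at hle
            rw [abs_of_pos hgp, abs_of_nonneg (by linarith : 0 ≤ g + Q)] at hgQ_lt
            rw [abs_of_nonneg hle] at hQg; linarith
          have : Q + (r :: tl).sum < 0 := by
            rw [abs_of_neg hQn'] at hrs_lt; linarith [le_abs_self (r :: tl).sum]
          exact mul_neg_of_pos_of_neg hgp this
      have hst := hsharp ⟨u + 1, hj, hgpow⟩ hsgn
      -- but `|Q + Σ rs| ≥ |Q| − |Σ rs| > 2^u − 2^(u-1) = ulp g / 2`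
      have hS_lt : |(r :: tl).sum| < (2 : ℚ) ^ (u - 1) := by
        refine inv.sum_lt.trans_le ?_
        rw [hK]
        refine zpow_le_zpow_right₀ (by norm_num) ?_
        have : (2 : ℚ) ^ (k + p - 1) ≤ 2 ^ u := hQnorm.trans hQeq.le
        have := (zpow_le_zpow_iff_right₀ (by norm_num : (1 : ℚ) < 2)).mp this
        omega
      have hhalf : ulp p emin g / 2 = 2 ^ (u - 1) := by rw [hU, zpow_sub_one₀ h2]; ring
      rw [hhalf] at hst
      have htri2 : |Q| - |(r :: tl).sum| ≤ |Q + (r :: tl).sum| := by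
        have := abs_add_le (Q + (r :: tl).sum) (-(r :: tl).sum)
        rw [abs_neg, add_neg_cancel_right] at this
        linarith
      have h2u : (2 : ℚ) ^ u = 2 * 2 ^ (u - 1) := by rw [zpow_sub_one₀ h2]; ring
      linarith
    -- from `2^(k+p-1) ≤ |Q| < |g + Q| = 2^a`: `ulp Q = 2^k ≤ 2^(a-p) = ulp(g + Q)/2`
    have hka : k ≤ a - p := by
      have : (2 : ℚ) ^ (k + p - 1) < 2 ^ a := hQnorm.trans_lt (by rw [← hQn]; exact hQlt)
      have := (zpow_lt_zpow_iff_right₀ (by norm_num : (1 : ℚ) < 2)).mp this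
      omega
    have hulpQn : ulp p emin (g + Q) = 2 ^ (a - p + 1) := by
      rw [← ulp_abs, hQn, ulp_two_zpow (by omega)]
    have hcmp : ulp p emin Q / 2 ≤ ulp p emin (g + Q) / 4 := by
      have e : (2 : ℚ) ^ (a - p + 1) / 4 = 2 ^ (a - p - 1) := by
        rw [show a - p + 1 = (a - p - 1) + 2 by ring, zpow_add₀ h2]; norm_num
      have e' : (2 : ℚ) ^ k / 2 = 2 ^ (k - 1) := by rw [zpow_sub_one₀ h2]; ring
      rw [hK, hulpQn, e, e']
      exact zpow_le_zpow_right₀ (by norm_num) (by omega)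
    exact hI.trans (mul_le_mul_of_nonneg_right hcmp (geomFactor_nonneg _))

end Summit.Ventures.CertifiedArithmetic.Expansions
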